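import Literature.AlgebraicGeometry.HodgeTheory.HodgeModelExistence
import Literature.AlgebraicGeometry.Motives.Sweep1
import HarnessLib

/-!
# The Hodge conjecture for cubic fourfolds (Zucker 1977; Murre 1977), on real carriers

Family `hodge`, layer `Literature/AlgebraicGeometry/HodgeTheory`. A KNOWN CASE of the Hodge
conjecture stated `B`-free on the real carriers of this layer (classes
`c ∈ H⁴(X(ℂ); ℂ) = Literature.AlgebraicTopology.SingularHomology.singularCohomology ℂ ℂ (ComplexPoints X) 4`,
rationality `IsRationalClass c`, Hodge type `IsOfHodgeType 4 X 4 2 2 c`, algebraicity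
`c ∈ algebraicClasses X 2 = N² H⁴`), in the pattern of the sibling files `LefschetzOneOne` and
`FermatHodgeConjecture`:

* `hodgeTwoTwo_algebraic_cubicFourfold` — **every rational `(2,2)`-class on a smooth cubic
  fourfold `X ⊂ ℙ⁵_ℂ` is algebraic.** Zucker, Compositio Math. 34 (1977), (3.2) THEOREM (p. 206),
  verbatim: "(Hodge Conjecture for cubic fourfolds): Let `X` be a non-singular cubic fourfold. Then
  every rational cohomology class in `H^{2,2}(X)` is the fundamental class of an algebraic cycle
  with rational coefficients." (proof by normal functions on the pencil of cubic threefolds, §3;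
  App. A: Clemens' alternate proof via the families of lines). Independently Murre, Indag. Math. 80
  (1977) 230–232, p. 230, verbatim: "THEOREM. If `X` is a smooth, projective unirational fourfold
  (i.e. a variety of dimension 4) then the Hodge `(2,2)`-conjecture is true. … COROLLARY. The Hodge
  `(2,2)`-conjecture is true for a smooth cubic fourfold in projective space `ℙ₅`." (with Remark 1,
  ibid.: "the `(1,1)` and `(3,3)`-conjecture are true for any fourfold").

Requested by the grounding of route `HodgeConjecture/CurveNetMordellWeil`, support item
`CubicFourfoldNormalForm` (stmt-HodgeConjecture-2791): that item is this fact composed with the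
route's `AlgebraicInNormalForm` at `p = 2` (algebraic classes of codimension 2 on a fourfold are
Gysin images of divisor classes from threefolds).

## Rendering and faithfulness

* `X` ranges over `ℂ`-schemes with `Motives.IsSmoothHypersurface 4 3 X` (file `Motives/Sweep1`: a
  smooth projective geometrically integral fourfold which is the hypersurface `V₊(F) ⊆ ℙ⁵_ℂ` of an
  irreducible cubic form `F`) — Zucker's "non-singular cubic fourfold", Murre's "smooth cubic
  fourfold in `ℙ₅`".
* "every rational cohomology class in `H^{2,2}(X)` is the fundamental class of an algebraic cycle
  with rational coefficients" is membership in `algebraicClasses X 2` for a rational class of Hodge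
  type `(2,2)` (module docstring of `LefschetzOneOne`: `ℚ`-span and `ℂ`-span membership agree for
  rational classes; "rational class of type `(2,2)`" is `IsRationalClass c ∧ IsOfHodgeType 4 X 4 2 2 c`,
  `∃` over Hodge models, junk analysis in `RationalHodgeClasses`).
* Only the degree-4 (codimension-2) statement is vendored — the printed theorem; degrees 2 and 6
  on a fourfold are Lefschetz `(1,1)` and its hard-Lefschetz dual (Murre's Remark 1), separate facts.
  Murre's general unirational statement is NOT vendored (no `IsUnirational` predicate in the tree).
* The `B`-relative counterpart against an abstract Betti–Hodge datum is
  `Motives.ZuckerCubicFourfoldStatement B` (`Motives/Sweep1`), a hypothesis schema; the present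
  file is the `B`-free form on the carriers of the summit statement.
* Upper bound: an instance of the summit statement (`…_of_hodgeConjectureFor`), so nothing
  stronger than the Hodge conjecture is claimed.

## References

* [Zucker1977] S. Zucker, The Hodge conjecture for cubic fourfolds, Compositio Math. 34 (1977)
  199–209, (3.2) Theorem p. 206 (text read, numdam).
* [Murre1977] J. P. Murre, On the Hodge conjecture for unirational fourfolds, Indag. Math. 80
  (1977) 230–232, Theorem and Corollary p. 230 (text read).
* [ConteMurre1978] A. Conte, J. P. Murre, Math. Ann. 238 (1978) 79–88 (fourfolds covered by
  rational curves; cite-only).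
* [Deligne2000] P. Deligne, The Hodge conjecture (Clay, 2000), §1.
-/

noncomputable section

namespace Literature.AlgebraicGeometry.HodgeTheory

section HodgeTheory

/-! ### The named fact -/

/-- **The Hodge conjecture for cubic fourfolds (Zucker 1977, Thm. (3.2); Murre 1977, Corollary),
cycle part on real carriers.** Zucker, Compositio Math. 34 (1977), p. 206: "(3.2) THEOREM (Hodge
Conjecture for cubic fourfolds): Let `X` be a non-singular cubic fourfold. Then every rational
cohomology class in `H^{2,2}(X)` is the fundamental class of an algebraic cycle with rational
coefficients." Murre, Indag. Math. 80 (1977), p. 230: "COROLLARY. The Hodge `(2,2)`-conjecture is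
true for a smooth cubic fourfold in projective space `ℙ₅`" (from his THEOREM for smooth projective
unirational fourfolds). Rendering: for `X` a smooth cubic hypersurface of dimension `4` over `ℂ`
(`Motives.IsSmoothHypersurface 4 3 X`), every rational class of Hodge type `(2,2)` in
`H⁴(X(ℂ); ℂ)` lies in `algebraicClasses X 2`. Grounds
`Summit.HodgeConjecture.HodgeConjecture.Theses.CurveNetMordellWeil.CubicFourfoldNormalForm`
(with that route's `AlgebraicInNormalForm`, `p = 2`).
[cite: Zucker1977, (3.2) Theorem, p. 206] [cite: Murre1977, Theorem and Corollary, p. 230] -/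
def hodgeTwoTwo_algebraic_cubicFourfold : Prop :=
  ∀ ⦃X : Motives.SchemeOver ℂ⦄, Motives.IsSmoothHypersurface 4 3 X →
    ∀ c : Literature.AlgebraicTopology.SingularHomology.singularCohomology ℂ ℂ (Motives.ComplexPoints X) (2 * 2),
      IsRationalClass c → IsOfHodgeType 4 X (2 * 2) 2 2 c → c ∈ algebraicClasses X 2

variable {X : Motives.SchemeOver ℂ}

/-! ### Upper bound: the fact is an instance of the Hodge conjecture -/

/-- The Hodge conjecture for all smooth projective varieties (the summit statement, spelled with
`HodgeConjectureFor`) implies the cubic-fourfold statement: it is its instance in degree `4` over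
smooth cubic fourfolds. [cite: Deligne2000, §1] -/
theorem hodgeTwoTwo_algebraic_cubicFourfold_of_hodgeConjectureFor
    (h : ∀ ⦃n : ℕ⦄ ⦃X : Motives.SchemeOver ℂ⦄, Motives.IsSmoothProjective n X → HodgeConjectureFor n X) :
    hodgeTwoTwo_algebraic_cubicFourfold :=
  fun _ hX c hc hpp ↦ (h hX.1).2 2 c hc hpp

/-! ### Span form (the spelling used by route items) -/

/-- **Span form**: on a smooth cubic fourfold the `ℂ`-span of the rational `(2,2)`-classes is
contained in `algebraicClasses X 2` (`Submodule.span_le`). [cite: Zucker1977, (3.2) Theorem, p. 206] -/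
theorem span_rational_hodgeTwoTwo_le_algebraicClasses_cubicFourfold
    (h : hodgeTwoTwo_algebraic_cubicFourfold) (hX : Motives.IsSmoothHypersurface 4 3 X) :
    Submodule.span ℂ {c : Literature.AlgebraicTopology.SingularHomology.singularCohomology ℂ ℂ
        (Motives.ComplexPoints X) (2 * 2) | IsRationalClass c ∧ IsOfHodgeType 4 X (2 * 2) 2 2 c} ≤
      algebraicClasses X 2 :=
  Submodule.span_le.mpr fun c hc ↦ h hX c hc.1 hc.2

end HodgeTheory

end Literature.AlgebraicGeometry.HodgeTheory

end
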